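import Mathlib
import HarnessLib
import HarnessLib.Audit
import Summits.AtomisticToContinuum.Statement
import Literature.Barriers.AtomisticToContinuum.FixedLengthNoConductivityControl
import Literature.MathematicalPhysics.KineticTheory.LangevinChainKernel
import Literature.MathematicalPhysics.KineticTheory.LangevinChainGibbs
import Literature.MathematicalPhysics.KineticTheory.LangevinChainNESS
import Summits.AtomisticToContinuum.FouriersLaw.Theorems.EmbeddedDrudeMourreNessUnique
import Summits.AtomisticToContinuum.FouriersLaw.Theorems.FourierGreenKuboFourierFiniteResponseOfUnique

/-!
Route: BondHeatFTUR

CLOSED (retired) 2026-08-15T13:41:08Z by operator:999:1257524 — reason: not-a-thesis: assembly does not conclude the sub-problem Statement — note: D-0027 §2.1 audit (human 2026-08-15: routes that do not decide the summit are removed): the assembly concludes `Literature.MathematicalPhysics.KineticTheory.HeatConduction.FouriersLaw`, not the sub-problem statement; a NEW conforming route may be opened from the same idea (generated `closes : … → _r. The file is kept as the record of this route; refuted decls are indexed as negative knowledge (`ledger negatives`).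

# Route BondHeatFTUR — linear-response fluctuation-theorem uncertainty relation: sqrt(t) bond-heat
variance + extensive snapshot irreversibility => G_N = O(kappa/N)

X = (S) ∧ (K) ∧ (★): "it suffices to show" three statements, realising idea card
AtomisticToContinuum/FouriersLaw/lr-ftur-conductance-scaling (spine; its retired twin
ftur-transfer-bond-heat-variance is the same text). Notation: P = pinnedChain ω₂ lam β γ (all four >
0), T > 0; C_N(b,s) := ∫ j_b(z) (P_s j_b)(z) dμ_T^N(z) is the EQUILIBRIUM autocorrelation of the
energy current through bond (b,b+1) of the N-site chain with BOTH Langevin baths at T (constructed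
kernels OscillatorChain.transitionKernel P N T T s and OscillatorChain.gibbsMeasure P N T, as in
route EscapeDeficit); V_N(b,t) := 2∫_0^t (t−s) C_N(b,s) ds = Var_eq(Q_t^(b)), Q_t^(b) = ∫_0^t j_b,
the equilibrium BOND-HEAT VARIANCE; D_N = lim_{δ→0} totalCurrent(μ_{N,T+δ/2,T−δ/2})/δ the BLR
response coefficient of clause (ii) and G_N := D_N/(N−1) the conductance; K_N := limsup_{δ→0} δ⁻²
KL(μ_{N,δ} ‖ Θ_*μ_{N,δ}) the SNAPSHOT IRREVERSIBILITY of the steady state (Θ = momentum flip; K_N =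
2‖h_N^odd‖²_{L²(μ_T)}, the L²-size of the odd part of the linear-response density).
(S) SubdiffusiveBondHeat (rank 2): ∃ A, c > 0: for all large N some bond b_N has V_N(b_N,t) ≤ A√t
for 1 ≤ t ≤ cN² (Edwards–Wilkinson ¼-law of the single-bond heat up to the Thouless time).
(K) ExtensiveSnapshotIrreversibility (rank 3): ∃ C: KL(μ_{N,δ} ‖ Θ_*μ_{N,δ}) ≤ C·N·δ² for δ near 0,
every N.
(★) LinearResponseFTUR (rank 4, fixed N): D_N ≥ 0 and 2 G_N² t² ≤ V_N(b,t) · (G_N t/T² + K) for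
every bond b, every t > 0 and every K ≥ 0 with KL(μ_{N,δ} ‖ Θ_*μ_{N,δ}) ≤ Kδ² eventually —
Hasegawa–Van Vu's fluctuation-theorem uncertainty relation for the Θ̃-odd observable Q_t^(b),
divided by 2δ² in BLR's order δ → 0, using ⟨Σ_t⟩ = σt + KL(μ‖Θ_*μ), σ = G_Nδ²/T².
Then, by real arithmetic at t = cN² with K = CN (support TransferToBoundedResponse, PROVED
sorry-free in the planner folder): 0 ≤ D_N ≤ B(T) for all N, i.e. the shared waypoint
BoundedResponse (stmt-2187 = HasBoundedResponse for pinnedChain, crux of FeketeResistance, support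
of LocalOhmRigidity/TwoChannelDephasing) is DISCHARGED; and from the light-cone version of (S) alone
(LightConeBondHeat, t ≤ aN) G_N ≤ c₁N^(−1/2) + c₂N^(−1/4) → 0, i.e. NonBallistic (stmt-2192, crux of
SuperadditiveJunction) is discharged (TransferToNonBallistic, PROVED). FouriersLaw = BoundedResponse
+ the complement every line needs: clause (i) (fact CuneoEckmannHairerReyBellet2018_pinnedChain,
PROVED, + NessUnique 0741), existence of D_N (FiniteResponseOfUnique 0717) and convergence of D_N in
(0,+∞] (import slot PositiveOrInfiniteLimit = "not insulating + non-oscillation", the output of the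
Fekete / superadditive-junction engines).
Lean: `SubdiffusiveBondHeat ∧ ExtensiveSnapshotIrreversibility ∧ LinearResponseFTUR`

## Assembly
Glue (elementary, ~100 lines, same pattern as FeketeResistance/SuperadditiveJunction assemblies):
fix parameters > 0. Clause (i): existence from the PROVED fact
CuneoEckmannHairerReyBellet2018_pinnedChain (N ≥ 1) / OscillatorChain.isSteadyState_zero (N = 0),
uniqueness from NessUnique. BoundedResponse from TransferToBoundedResponse fed with (★), (S), (K),
NessUnique. Clause (ii): choose the canonical family μ₀ (choice from (i); junk at non-positive
temperatures) and, for T > 0, D₀(T) from FiniteResponseOfUnique; PositiveOrInfiniteLimit gives ℓ ∈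
(0,+∞] ⊂ EReal with D₀ → ℓ; BoundedResponse gives |D₀ N| ≤ S, so ℓ ≤ S < ⊤, ℓ = ↑κ_T with κ_T > 0
real and D₀ → κ_T in ℝ (EReal.tendsto_coe); set κ T := κ_T for T > 0, 1 otherwise. For an arbitrary
steady-state family μ, uniqueness gives μ N a b = μ₀ N a b for a, b > 0, so the difference quotients
agree for |δ| < 2T and D₀(T) serves as its response sequence (Filter.Tendsto.congr',
tendsto_nhds_unique, as in hasBoundedResponse_iff_of_unique); finish with the landed frame
Literature.HeatConduction.fouriersLaw_of_steadyState_and_linearResponse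
(Theorems/FourierGreenKuboAssembly.lean).

Rationale: WHY THIS LINE. A steady current through a bond makes the bond's heat record distinguishable from its
time-reverse; distinguishability is capped by the path-space entropy production, which at linear
response is EXACTLY σt + KL(μ‖Θ_*μ) with σ = G_Nδ²/T² proportional to the current itself — so the
fluctuation-theorem uncertainty relation (HasegawaVanVu2019 arXiv:1902.06376;
underdamped/initial-state term VanVuHasegawa2019 arXiv:1901.05715; HCR/χ² form DechantSasa2020;
long-time TUR book:gaspard2022-statistical-mechanics-irreversible-phenomena p.389 eq. (5.114), which
SATURATES at linear response by the open-chain Kubo identity KunduDharNarayan2009) caps the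
conductance by how noisy the bond heat is AT EQUILIBRIUM at FINITE t: 2G_N²t² ≤ Var_eq(Q_t)(G_Nt/T²
+ K_N). Imported area: information geometry / stochastic thermodynamics (Cramér–Rao–type
inequalities, Gallavotti–Cohen/Evans–Searles fluctuation theorem, proved at fixed N for exactly
these chains: ReyBelletThomas2002AHP, EckmannPilletReyBellet1999b), used as a TRANSFER device from
equilibrium dynamics to NESS scaling. Evaluated at the Thouless time t = cN², a √t
(first-absolute-moment, Edwards–Wilkinson) spreading bound — strictly weaker than the
second-moment/Green–Kubo statement behind route FourierGreenKubo (MendlSpohn2015 arXiv:1412.4609 §4,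
Spohn2014; model case SSEP doi:10.1023/a:1014577928229) — plus an extensive bound on the static
snapshot irreversibility give G_N = O(1/N) with explicit constant, i.e. HasBoundedResponse, WITHOUT
κ = κ_GK, resolvent convergence, relaxation rates, local equilibrium or hydrodynamic limits; the
inequality amplifies the plain Cauchy–Schwarz use of the same static object (card
static-irreversibility-loschmidt-echo needs ‖h^odd‖² = O(1/N)) by a factor N², and with light-cone
data only (t ≤ aN, where the open chain is the infinite chain by finite speed of propagation,
ButtaEtAl2007) it already yields G_N → 0, the cheapest sufficient condition for non-ballisticity on
the ledger. No prior route uses an information inequality; the negatives index is empty.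

RANKED CRUXES. #2 SubdiffusiveBondHeat (crux) — (S) card item U2. For P = pinnedChain ω₂ lam β γ
(all > 0) and T > 0, with C_N(b,s) = ∫ j_b · (P_s j_b) dμ_T^N (constructed transitionKernel at equal
bath temperatures T, gibbsMeasure) and V_N(b,t) = 2∫_0^t (t−s)C_N(b,s)ds the equilibrium variance of
the heat Q_t^(b) through bond (b,b+1): ∃ A, c > 0, N₀ such that every N ≥ N₀ has a bond b (b+1 < N;
the prover picks it, e.g. the middle bond) with V_N(b,t) ≤ A√t for all 1 ≤ t ≤ cN². Reading: by
conservation V = 2Σ_z|z|[S(z,0) − S(z,t)] + boundary terms (MendlSpohn2015 §4 (4.6)), so this bounds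
the FIRST ABSOLUTE MOMENT of equilibrium energy spreading by √t up to the Thouless time — implied by
(Cauchy–Schwarz), and strictly weaker than, a diffusive second-moment / Green–Kubo bound; it asks
nothing about convergence of ∫C_J or κ = κ_GK. Model case: √t (fBM-¼) bond-current fluctuations of
SSEP (De Masi–Ferrari; Peligrad–Sethuraman). Only the value t = cN² is consumed by the transfer; the
window form is the natural statement and contains LightConeBondHeat. [difficulty: XL] (why it might
fail: A diffusive (EW ¼-law) bound for a deterministic anharmonic chain — nothing of the kind is
proved (BLR2000 §6.3); it encodes the cancellation ∫C_b ≈ T²G_N ≈ 0 at rate s^(-3/2) up to t ~ N²;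
fails if energy spreads superdiffusively or bath-injected heat decorrelates slower than
diffusively.) [MendlSpohn2015, Spohn2014, doi:10.1023/a:1014577928229, arXiv:0711.0017,
BonettoLebowitzReyBellet2000, KunduDharNarayan2009, ButtaEtAl2007]
#3 ExtensiveSnapshotIrreversibility (crux) — (K) card item U3. Under weak-NESS uniqueness, for every
steady-state family μ of pinnedChain ω₂ lam β γ (all > 0) and T > 0: ∃ C such that for every N,
eventually as δ → 0 (δ ≠ 0), KL(μ_{N,T+δ/2,T−δ/2} ‖ Θ_*μ_{N,T+δ/2,T−δ/2}) ≤ C·N·δ², Θ(q,p) = (q,−p)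
(Mathlib InformationTheory.klDiv, Measure.map). Reading: K_N := limsup δ⁻²KL =
2‖h_N^odd‖²_{L²(μ_T)}, h^odd = ½∫_0^∞(P_s − P_s^*)ρ_src ds the odd part of the linear-response
density — 'how much of the arrow of time is visible in one snapshot of the steady state'. Extensive
is generous: kinetic/diffusive phenomenology gives K_N = O(1) (local odd corrections O(δ/N) per site
plus long-range pair correlations O(δ/N)), and the BALLISTIC harmonic chain has K_N ≈ 0.16·N (exact
Gaussian computation, Numbers) — all the diffusive input of the line sits in (S). N = 0, 1: KL = 0.
Expected engine: locality of the odd response (odd corrector = gradient × cell correctors), NOT ‖h‖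
≤ ‖ρ_src‖/gap. [difficulty: L] (why it might fail: No a priori bound on K_N = 2‖h_odd‖² beyond gap⁻²
(gap ≲ γ/N always; N⁻³ harmonic, BeckerMenegaki2022); long-range odd NESS correlations could make
K_N ~ N^k, k > 1 (k ≤ 1 needed for boundedness, k < 3 for G_N → 0); KL finite needs a positive
smooth density.) [VanVuHasegawa2019, EckmannPilletReyBellet1999b, CuneoEckmannHairerReyBellet2018,
BeckerMenegaki2022, RiederLebowitzLieb1967, BonettoLebowitzReyBellet2000]
#4 LinearResponseFTUR (crux) — (★) card item U1, the engine, FIXED N. Under weak-NESS uniqueness,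
for every steady-state family μ, T > 0 and response coefficients D (the δ-limits of clause (ii)):
for every N ≥ 2, (a) D_N ≥ 0 (entropy production ⟨Σ_t⟩ = σt + KL ≥ 0 for all t forces σ = G_Nδ²/T² +
o(δ²) ≥ 0), and (b) for every bond b, every t > 0 and every K ≥ 0 with KL(μ_{N,δ}‖Θ_*μ_{N,δ}) ≤ Kδ²
eventually: 2G_N²t² ≤ V_N(b,t)·(G_N t/T² + K), G_N = D_N/(N−1), V_N as in (S). Derivation (checked
by a refuter audit and, numerically, on the harmonic chain — Numbers): Σ_t := log
dP_δ^[0,t]/dΘ̃_*P_δ^[0,t] (Θ̃ = time reversal ∘ momentum flip of the stationary path measure)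
satisfies the joint detailed fluctuation theorem with the Θ̃-odd Q_t^(b), hence Hasegawa–Van Vu:
⟨Q_t⟩² ≤ ½Var_δ(Q_t)(e^{⟨Σ_t⟩} − 1) at every δ; ⟨Q_t⟩ = G_Nδt(1+o(1)) (equal mean bond currents),
⟨Σ_t⟩ = σ_δ t + KL(μ_δ‖Θ_*μ_δ) with σ_δ = J_δ(1/T_R − 1/T_L) (EckmannPilletReyBellet1999b;
ReyBelletThomas2002AHP), Var_δ(Q_t) → V_N(b,t) as δ → 0 (Gibbs invariance + Markov property of the
constructed kernels: Var_eq(∫_0^t j_b) = 2∫_0^t(t−s)C_N(b,s)ds since μ_T(j_b) = 0); divide by δ² and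
let δ → 0. Saturates as t → ∞ (V ~ 2T²G_N t, KunduDharNarayan2009: TUR is tight at linear response),
so all information sits at finite t; at t → 0 it reduces to the Cauchy–Schwarz bound K_N ≥
2G_N²/⟨j_b²⟩. [difficulty: L] (why it might fail: Fixed N but delicate: needs P_δ ~ Θ̃_*P_δ on path
space with ⟨Σ_t⟩ = σt + KL(μ_δ‖Θμ_δ) (smooth positive NESS density, Girsanov in the two noisy
momenta only), δ-continuity of Var_δ(Q_t), Gibbs-invariance of the constructed kernels and equal
mean bond currents (0717-level input).) [HasegawaVanVu2019, VanVuHasegawa2019, DechantSasa2020,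
ReyBelletThomas2002AHP, EckmannPilletReyBellet1999b, KunduDharNarayan2009,
book:gaspard2022-statistical-mechanics-irreversible-phenomena p.389 (5.114),
CuneoEckmannHairerReyBellet2018]
#9 LightConeBondHeat (support) — (S_lc) the light-cone special case of (S) (card U2 fallback / U4):
same objects, window 1 ≤ t ≤ a·N only — inside the cone t ≤ N/(2v) a bulk bond of the open chain
does not feel the baths (thermal Lieb–Robinson / finite-speed bounds for quartic chains,
ButtaEtAl2007), so this is the √t law of the INFINITE equilibrium chain transported to the open one.
Literally implied by SubdiffusiveBondHeat (take N ≥ a/c); filed separately because with (K) and (★)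
it alone gives G_N → 0 (TransferToNonBallistic). The cheapest N-uniform statement of the line.
[difficulty: XL] [ButtaEtAl2007, MendlSpohn2015, Spohn2014, doi:10.1023/a:1014577928229]
#9 TransferToBoundedResponse (support) — GLUE, PROVED sorry-free in the planner folder (Sketch.lean,
theorem transferToBoundedResponse_holds, axioms propext/Classical.choice/Quot.sound; ~110 lines of
real arithmetic, copy into Theorems/): LinearResponseFTUR → SubdiffusiveBondHeat →
ExtensiveSnapshotIrreversibility → NessUnique → BoundedResponse. Proof: at N ≥ max(N₀, 2, ⌈1/c⌉)
take the bond of (S), t = cN² (≥ 1), K = max(C,0)·N; since G_N ≥ 0 and K ≥ 0 the factor G_Nt/T² + K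
is ≥ 0, so V may be replaced by its bound max(A,0)√c·N WITHOUT any sign information on V; with x =
N·G_N this reads 2c²x² ≤ Px + Q, hence x ≤ max(1,(P+Q)/(2c²)) and 0 ≤ D_N ≤ N·G_N; finitely many
small N are absorbed. Mesh test of the typed quantifiers: passed. [difficulty: provable-now]
[BonettoLebowitzReyBellet2000, HasegawaVanVu2019]
#9 TransferToNonBallistic (support) — GLUE for the qualitative rung, PROVED sorry-free in the
planner folder (theorem transferToNonBallistic_holds): LinearResponseFTUR → LightConeBondHeat →
ExtensiveSnapshotIrreversibility → NessUnique → NonBallistic. Proof: at t = aN, with r = √N, (★)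
gives 2a²rG² ≤ PG + Q; if G_N > ε then 2a²εr < P + Q/ε, i.e. N < ((P + Q/ε)/(2a²ε))², so beyond that
length D_N ≤ ε(N−1). Quantitatively G_N ≤ c₁N^(−1/2) + c₂N^(−1/4), D_N = O(N^(3/4)): sub-ballistic
transport from light-cone equilibrium data + data processing alone. [difficulty: provable-now]
[BonettoLebowitzReyBellet2000, HasegawaVanVu2019]
#9 BoundedResponse (support) — SHARED WAYPOINT (identical signature to FeketeResistance's crux
stmt-AtomisticToContinuum-2187; support in LocalOhmRigidity, TwoChannelDephasing):
Literature.Barriers.AtomisticToContinuum.HasBoundedResponse (pinnedChain ω₂ lam β γ) for all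
parameters > 0 — |D_N| bounded in N along every steady-state family. In THIS route it is an OUTPUT
(TransferToBoundedResponse), not a hypothesis of the Assembly: a prover holding (★), (S), (K) and
NessUnique closes 2187 for every route wanting it. [difficulty: open-problem]
[BonettoLebowitzReyBellet2000, Literature.Barriers.AtomisticToContinuum.HasBoundedResponse]
#9 NonBallistic (support) — SHARED (identical signature to SuperadditiveJunction's crux
stmt-AtomisticToContinuum-2192): under weak-NESS uniqueness, for every steady-state family, T > 0
and response coefficients D: ∀ ε > 0 there are arbitrarily long chains with D_N ≤ ε(N−1) (the
conductance is not bounded away from 0). In THIS route it is the OUTPUT of the light-cone rung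
(TransferToNonBallistic), not used by the Assembly. [difficulty: XL] [BonettoLebowitzReyBellet2000,
Mazur1969]
#9 NessUnique (support) — SHARED (stmt-AtomisticToContinuum-0741, identical signature): uniqueness
of the weak steady state (IsSteadyState class) of pinnedChain ω₂ lam β γ (all > 0) for every N, T_L,
T_R > 0. Hypothesis of (K), (★) and the transfers; with the PROVED fact
CuneoEckmannHairerReyBellet2018_pinnedChain it gives clause (i). [difficulty: L]
[CuneoEckmannHairerReyBellet2018, Carmona2007]
#9 FiniteResponseOfUnique (support) — SHARED (stmt-AtomisticToContinuum-0717, identical signature):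
under weak-NESS uniqueness the finite-N response limits D_N(T) exist for every steady-state family,
T > 0, N. Needed by the Assembly to produce D at all (the cruxes are vacuous along families without
response limits). [difficulty: L] [ReyBellet2003, HairerMajda2009, CuneoEckmannHairerReyBellet2018]
#9 PositiveOrInfiniteLimit (support) — IMPORT SLOT (what this line does NOT supply: a lower bound
and existence of the limit). Under weak-NESS uniqueness, for every steady-state family, T > 0 and
response coefficients D: D_N converges in EReal to some ℓ ∈ (0, +∞]. NECESSARY for the conjunct (D_N
→ κ(T) > 0), so not too strong; together with BoundedResponse it gives D_N → κ ∈ (0,∞). Suppliers: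
FeketeResistance minus its crux (B) (QuasiSubadditiveResistance + PositiveConductance + Fekete on {N
≥ 2} give R_N/N → ℓ' ∈ [0,∞), i.e. D_N → 1/ℓ' ∈ (0,+∞]); SuperadditiveJunction ((A)+(B)+(C) ⇒ real
positive limit); EscapeDeficit's bracket + EscapeNonOscillation. Dedup by signature will not catch
those — the tenure planner re-points the Assembly when one lands. Provers of THIS route should not
start here. [difficulty: L] [BonettoLebowitzReyBellet2000, Hammersley1988,
CanestrariLiveraniOlla2026]

TWO-LAYER PLAN. Foreseen glued splits (k ≤ 3, depth 1; nothing filed now): SubdiffusiveBondHeat ⇐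
InfiniteChainEW (√t law of the single-bond heat of the infinite equilibrium chain, first absolute
moment of energy spreading) → OpenVsInfinite (thermal Lieb–Robinson comparison for t ≤ N/2v,
ButtaEtAl2007) → BathWindow (extension to the Thouless window: bath-injected heat crossing a bulk
bond has variance controlled by half-chain energy fluctuations + far-bath heat) → S.
ExtensiveSnapshotIrreversibility ⇐ KLExpansion (fixed N: KL(μ_δ‖Θμ_δ) = 2δ²‖h^odd‖² + o(δ²)) →
OddCorrectorLocality (‖h_N^odd‖² ≤ CN from locality of the odd linear response) → K.
LinearResponseFTUR ⇐ EntropyBalance (Σ_t = log dP/dΘ̃_*P exists, ⟨Σ_t⟩ = σt + KL) → HVVAndContinuity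
(joint fluctuation theorem ⇒ Hasegawa–Van Vu; Var_δ → V_N; σ_δ/δ² → G_N/T²) → (★).

KILL CRITERIA. (a) ¬LinearResponseFTUR at some fixed N (an exact computation or theorem violating
(★), or ⟨Σ_t⟩ ≠ σt + KL(μ‖Θμ) for these thermostats) closes the route outright (close --reason
refuted:LinearResponseFTUR): the engine would be wrong; the exact Gaussian check on the harmonic
member passed (Numbers). (b) ¬SubdiffusiveBondHeat (equilibrium MD or a theorem showing V_N(b,cN²) ≫
N for every c, e.g. superdiffusive single-bond heat in the pinned chain): pivot to the light-cone
rung — the route survives as the NonBallistic engine (TransferToNonBallistic) or closes if even V =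
o(t) fails inside the cone. (c) ¬ExtensiveSnapshotIrreversibility with K_N ~ N^k: k ≤ 1 is needed
for bounded response, 1 < k < 3 still gives G_N → 0 through the Thouless window, k < 3/2 through the
light cone — restate (K) accordingly or close if k ≥ 3. (d) A hidden conserved quantity (Mazur)
refutes (S), NonBallistic and the conjunct together — file ¬FouriersLaw. (e) BoundedResponse proved
elsewhere moots the strong half (close --reason superseded, keep the NonBallistic rung if still
wanted).

NOT DECOMPOSED YET. The engines inside (S) (infinite-chain EW law, Lieb–Robinson comparison, bath
window), the fixed-N lemmas inside (★) (Girsanov density in the two noisy momenta, entropy balance,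
δ-continuity, kernel/Gibbs invariance = EscapeDeficit's BoundaryKernelBasics(a)), the KL expansion
and the locality engine inside (K); T-dependence of A, c, C, B; the identification K_N = 2‖h^odd‖²
(not needed by any statement); the CONTACT-heat version of (★) (boundary arena, no bulk bond); the
suppliers of PositiveOrInfiniteLimit (other routes). All are layer-2 children after a crux moves
(D-0019).

CHEAPEST FALSIFIER. Exact Gaussian linear algebra on the pinned HARMONIC member pinnedChain ω₂ 0 0
γ, where (★) and (K) must still hold and (S) must fail — RUN by this planner (folder
ftur_harmonic_check.py, pure Python < 40 s; Lyapunov equation for the NESS covariance, Isserlis for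
C_b(s), ω₂ = γ = T = 1, N = 2, 3, 4, 6): (★) holds for every bond and every t ∈ (0, 300] with min
RHS/LHS = 1.003, 1.011, 1.017, 1.034, decreasing to 1 as t → ∞ (tight, as predicted); ∫_0^∞ C_b ds =
T²G_N to 5 digits for EVERY bond (0.166678 vs 0.166667, …: the KDN normalisation behind the
saturation); K_N = 0.222, 0.339, 0.469, 0.781 ≈ 0.16·N (extensive: (K) holds at the ballistic
corner); G_N → 1/8 (ballistic, so (S) fails there, V ∝ t). Next cheapest, for a refuter with kit:
the same computation for N ≤ 200 (K_N/N → const? any bond/time where RHS/LHS < 1?) and equilibrium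
MD of V_N(b,t) for pinnedChain 1 1 1 1, N = 32…256, t ≤ N² (does V ≤ A√t persist to the Thouless
time; where does it cross over to 2T²G_N t?).

NUMBERS. Harmonic calibration (ω₂ = γ = T = 1, lam = β = 0; this planner's exact computation): G_2 =
1/6, G_3 = 0.13636, G_4 = 0.12791, G_6 = 0.12518 → fluxLimit 1/8; K_2 = 2/9, K_3 = 0.33884, K_4 =
0.46944, K_6 = 0.78087; ⟨j_b²⟩_T ∈ [0.278, 0.333] and the small-t consistency 2G_N²/⟨j_b²⟩ ≤ K_N
holds (0.167 ≤ 0.222, 0.119 ≤ 0.339, …); min_t RHS/LHS of (★) = 1.0028 (N = 2), 1.0105 (3), 1.0172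
(4), 1.0340 (6). Transfer constants: with V_N(b,cN²) ≤ A√c·N and K_N ≤ CN, N·G_N ≤ max(1, (A√c·c/T²
+ A√c·C)/(2c²)) (TransferToBoundedResponse); with the light cone t = aN, G_N ≤ c₁N^(−1/2) +
c₂N^(−1/4) (D_N = O(N^(3/4))). Tolerances: K_N ~ N^k keeps bounded response iff k ≤ 1, keeps G_N → 0
for k < 3 (Thouless window) / k < 3/2 (light cone). Expected diffusive values: V_N(b,t) ≈ A√t with A
∝ χ√D_th (χ = c_vT² energy susceptibility, D_th = κ/c_v), crossover to 2T²G_N t ≈ 2T²κt/N at t ≍ N²;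
kinetic phenomenology K_N = O(1) (even O(1/N) for the local part), far below CN. Items at open: 12
(3 cruxes, 8 support, 1 assembly).

DEFINITION REQUESTS. None needed now: every object is typed over existing declarations
(OscillatorChain.transitionKernel, OscillatorChain.gibbsMeasure,
OscillatorChain.bondCurrent/totalCurrent/IsSteadyState, InformationTheory.klDiv,
MeasureTheory.Measure.map, Literature.Barriers.AtomisticToContinuum.HasBoundedResponse). Worth a
shared Literature definition later if the sibling cards are routed: `bondHeatVariance P N T b t :=
2∫_0^t (t−s)C_N(b,s)ds` (also used by ew-quarter-law-bond-current,
dc-kirchhoff-flat-bond-conductivity) and `snapshotIrreversibility`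
(static-irreversibility-loschmidt-echo). No cite facts requested: the fixed-N fluctuation theorem
(ReyBelletThomas2002AHP) is re-derived inside (★) rather than imported as a named fact, because the
printed statement concerns a different reservoir model.

Novelty: Searches (2026-08-15, this planner, on top of the card's searches and its refuter novelty audit):
`lit frontier AtomisticToContinuum --since 2020` (30 rows; none on TUR/FTUR; arXiv:2602.07988
"Hierarchical Lorentz mirror model … universal 2/3 mean–variance" is a mean–variance LAW for a toy
model, not an inequality route to size scaling); `lit bridges AtomisticToContinuum --cross any` (30
rows, none relevant); `lit search --hybrid --source local "thermodynamic uncertainty relation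
entropy production current fluctuations underdamped"` (12 books; read
book:gaspard2022-statistical-mechanics-irreversible-phenomena pp. 389–390: §5.4.4 eq. (5.114)
long-time TUR σ ≥ J²/D, which saturates at linear response — confirms that only a FINITE-time
relation can carry information here); `lit search --source crossref "thermodynamic uncertainty
relation thermal conductivity size dependence"` (8 hits, nanoscale phonon engineering, 0 relevant);
`--source zbmath "thermodynamic uncertainty relation heat conduction"` (2 textbooks); `lit galaxy
search "thermodynamic uncertainty relation" --star all` (panama/pdf queues timed out twice, crabby 1
irrelevant) and `--star pdf "uncertainty relation"` (10, none on transport); openalex / arxiv / s2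
cascades answered HTTP 429 all session (recorded, not worked around); crossref look-ups of the SSEP
sources (doi:10.1023/a:1014577928229 found). Grep of all 16 FouriersLaw route files for
TUR/klDiv/snapshot/Cramér: no route uses an information inequality.
Nearest  [refs: 10.1023/a:1014577928229, 10.1103/physreve.100.032130:, 2602.07988, 1902.06376, 1901.05715, 0809.4543, 1412.4609, book:gaspard2022-statistical-mechanics-irreversible-phenomena, doi:10.1023/a, doi:10.1103/physreve.100.032130, HasegawaVanVu2019, VanVuHasegawa2019, DechantSasa2020, KunduDharNarayan2009, MendlSpohn2015]

Barriers (technique_class: information-inequality-ftur snapshot-irreversibility): - technique_class: information-inequality-ftur snapshot-irreversibility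
- Literature.Barriers.AtomisticToContinuum.HasBoundedResponse: met head-on as an OUTPUT
(TransferToBoundedResponse, proved): the N-uniformity is relocated into two named inputs, (S)
(equilibrium, dynamical, first absolute moment, diffusive time scale) and (K) (static, NESS),
neither a fixed-N statement; only (★) is fixed-N, and it is N-uniform by construction (constant 2,
no hidden C_N) — fixed-N technology is used exactly where it is legitimate.
- Literature.Barriers.AtomisticToContinuum.HarmonicChainBallisticFlux: consistent and used as
calibration — at lam = β = 0, (★) and (K) hold (exact check, K_N ≈ 0.16N) while (S) fails (∫C_b =
T²G_N = O(1), V ∝ t from t = O(1)), so the line cannot certify bounded response where it is false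
(not_hasBoundedResponse).
- Literature.Barriers.AtomisticToContinuum.Mazur1969_inequality: a conserved charge overlapping the
current makes V_N(b,t) ≍ t and falsifies (S)/(S_lc), never (★); the line is silent, not wrong, on
ballistic members, and a Mazur witness for lam, β > 0 would refute the conjunct itself.
- Literature.Barriers.AtomisticToContinuum.BeckerMenegaki2022_gapClosing: no spectral gap,
relaxation rate or hypocoercive constant enters (★) or the transfers; a proof of (K) via ‖h‖ ≤
‖ρ_src‖/gap is explicitly excluded (gap ≲ γ/N) — (K) must come from locality of the odd response.
- Literature.Barriers.AtomisticToContinuum.equilibrium_rate_bound: same class; (S) is a win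

History (route lifecycle, newest last):
- 2026-08-15T13:41:08Z · CLOSED retired — not-a-thesis: assembly does not conclude the sub-problem Statement (operator:999:1257524)

sub-problem: FouriersLaw · status: closed(retired) · opened planner-plancard-AtomisticToContinuum-Fourier-5735f19b-0 2026-08-15T11:43:52Z · rev 0 · ledger route-AtomisticToContinuum-BondHeatFTUR
GENERATED by the gate from the ledger (D-0016/17). Provers cite these decls: `theorem foo : Summit.AtomisticToContinuum.FouriersLaw.Theses.BondHeatFTUR.<Decl> := …` in Summits/AtomisticToContinuum/FouriersLaw/Theorems/<Name>.lean.
-/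

namespace Summit.AtomisticToContinuum.FouriersLaw.Theses.BondHeatFTUR

open scoped BigOperators Topology Manifold Classical MeasureTheory ProbabilityTheory Matrix InnerProductSpace ComplexConjugate ContinuousMap
open Filter Set Function TopologicalSpace MeasureTheory

attribute [summit_statement] _root_.FouriersLaw

/-- item stmt-AtomisticToContinuum-6006 · crux · rank 2 · closed · moot by None · by planner
why it might fail: A diffusive (EW ¼-law) bound for a deterministic anharmonic chain — nothing of the kind is proved (BLR2000 §6.3); it encodes the cancellation ∫C_b ≈ T²G_N ≈ 0 at rate s^(-3/2) up to t ~ N²; fails if energy spreads superdiffusively or bath-injected heat decorrelates slower than diffusively.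
sources: MendlSpohn2015, Spohn2014, doi:10.1023/a:1014577928229, arXiv:0711.0017, BonettoLebowitzReyBellet2000, KunduDharNarayan2009
[crux] (S) card item U2. For P = pinnedChain ω₂ lam β γ (all > 0) and T > 0, with C_N(b,s) = ∫ j_b ·
(P_s j_b) dμ_T^N (constructed transitionKernel at equal bath temperatures T, gibbsMeasure) and
V_N(b,t) = 2∫_0^t (t−s)C_N(b,s)ds the equilibrium variance of the heat Q_t^(b) through bond (b,b+1):
∃ A, c > 0, N₀ such that every N ≥ N₀ has a bond b (b+1 < N; the prover picks it, e.g. the middle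
bond) with V_N(b,t) ≤ A√t for all 1 ≤ t ≤ cN². Reading: by conservation V = 2Σ_z|z|[S(z,0) − S(z,t)]
+ boundary terms (MendlSpohn2015 §4 (4.6)), so this bounds the FIRST ABSOLUTE MOMENT of equilibrium
energy spreading by √t up to the Thouless time — implied by (Cauchy–Schwarz), and strictly weaker
than, a diffusive second-moment / Green–Kubo bound; it asks nothing about convergence of ∫C_J or κ =
κ_GK. Model case: √t (fBM-¼) bond-current fluctuations of SSEP (De Masi–Ferrari;
Peligrad–Sethuraman). Only the value t = cN² is consumed by the transfer; the window form is the
natural statement and contains LightConeBondHeat. [difficulty: XL] -/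
@[route_item "route-AtomisticToContinuum-BondHeatFTUR"]
def SubdiffusiveBondHeat : Prop :=
  ∀ ω₂ lam β γ : ℝ, 0 < ω₂ → 0 < lam → 0 < β → 0 < γ → ∀ T : ℝ, 0 < T → (let P := Literature.MathematicalPhysics.KineticTheory.HeatConduction.pinnedChain ω₂ lam β γ; let C : ℕ → ℕ → ℝ → ℝ := fun N b s => if h : b < N then ∫ z, P.bondCurrent N ⟨b, h⟩ z * (∫ y, P.bondCurrent N ⟨b, h⟩ y ∂(P.transitionKernel N T T s.toNNReal z)) ∂(P.gibbsMeasure N T) else 0; let V : ℕ → ℕ → ℝ → ℝ := fun N b t => 2 * ∫ s in (0 : ℝ)..t, (t - s) * C N b s; ∃ A c : ℝ, 0 < c ∧ ∃ N₀ : ℕ, ∀ N : ℕ, N₀ ≤ N → ∃ b : ℕ, b + 1 < N ∧ ∀ t : ℝ, 1 ≤ t → t ≤ c * (N : ℝ) ^ 2 → V N b t ≤ A * Real.sqrt t)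

/-- item stmt-AtomisticToContinuum-6007 · crux · rank 3 · closed · moot by None · by planner
why it might fail: No a priori bound on K_N = 2‖h_odd‖² beyond gap⁻² (gap ≲ γ/N always; N⁻³ harmonic, BeckerMenegaki2022); long-range odd NESS correlations could make K_N ~ N^k, k > 1 (k ≤ 1 needed for boundedness, k < 3 for G_N → 0); KL finite needs a positive smooth density.
sources: VanVuHasegawa2019, EckmannPilletReyBellet1999b, CuneoEckmannHairerReyBellet2018, BeckerMenegaki2022, RiederLebowitzLieb1967, BonettoLebowitzReyBellet2000
[crux] (K) card item U3. Under weak-NESS uniqueness, for every steady-state family μ of pinnedChain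
ω₂ lam β γ (all > 0) and T > 0: ∃ C such that for every N, eventually as δ → 0 (δ ≠ 0),
KL(μ_{N,T+δ/2,T−δ/2} ‖ Θ_*μ_{N,T+δ/2,T−δ/2}) ≤ C·N·δ², Θ(q,p) = (q,−p) (Mathlib
InformationTheory.klDiv, Measure.map). Reading: K_N := limsup δ⁻²KL = 2‖h_N^odd‖²_{L²(μ_T)}, h^odd =
½∫_0^∞(P_s − P_s^*)ρ_src ds the odd part of the linear-response density — 'how much of the arrow of
time is visible in one snapshot of the steady state'. Extensive is generous: kinetic/diffusive
phenomenology gives K_N = O(1) (local odd corrections O(δ/N) per site plus long-range pair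
correlations O(δ/N)), and the BALLISTIC harmonic chain has K_N ≈ 0.16·N (exact Gaussian computation,
Numbers) — all the diffusive input of the line sits in (S). N = 0, 1: KL = 0. Expected engine:
locality of the odd response (odd corrector = gradient × cell correctors), NOT ‖h‖ ≤ ‖ρ_src‖/gap.
[difficulty: L] -/
@[route_item "route-AtomisticToContinuum-BondHeatFTUR"]
def ExtensiveSnapshotIrreversibility : Prop :=
  ∀ ω₂ lam β γ : ℝ, 0 < ω₂ → 0 < lam → 0 < β → 0 < γ → (∀ (N : ℕ) (T_L T_R : ℝ), 0 < T_L → 0 < T_R → ∀ μ ν : MeasureTheory.Measure (Literature.MathematicalPhysics.KineticTheory.HeatConduction.PhaseSpace N), (Literature.MathematicalPhysics.KineticTheory.HeatConduction.pinnedChain ω₂ lam β γ).IsSteadyState N T_L T_R μ → (Literature.MathematicalPhysics.KineticTheory.HeatConduction.pinnedChain ω₂ lam β γ).IsSteadyState N T_L T_R ν → μ = ν) → ∀ μ : (N : ℕ) → ℝ → ℝ → MeasureTheory.Measure (Literature.MathematicalPhysics.KineticTheory.HeatConduction.PhaseSpace N), (∀ (N : ℕ) (T_L T_R : ℝ), 0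 < T_L → 0 < T_R → (Literature.MathematicalPhysics.KineticTheory.HeatConduction.pinnedChain ω₂ lam β γ).IsSteadyState N T_L T_R (μ N T_L T_R)) → ∀ T : ℝ, 0 < T → ∃ C : ℝ, ∀ N : ℕ, ∀ᶠ δ in nhdsWithin (0 : ℝ) {(0 : ℝ)}ᶜ, InformationTheory.klDiv (μ N (T + δ / 2) (T - δ / 2)) (MeasureTheory.Measure.map (fun x : Literature.MathematicalPhysics.KineticTheory.HeatConduction.PhaseSpace N => (x.1, -x.2)) (μ N (T + δ / 2) (T - δ / 2))) ≤ ENNReal.ofReal (C * (N : ℝ) * δ ^ 2)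

/-- item stmt-AtomisticToContinuum-6008 · crux · rank 4 · closed · moot by None · by planner
why it might fail: Fixed N but delicate: needs P_δ ~ Θ̃_*P_δ on path space with ⟨Σ_t⟩ = σt + KL(μ_δ‖Θμ_δ) (smooth positive NESS density, Girsanov in the two noisy momenta only), δ-continuity of Var_δ(Q_t), Gibbs-invariance of the constructed kernels and equal mean bond currents (0717-level input).
sources: HasegawaVanVu2019, VanVuHasegawa2019, DechantSasa2020, ReyBelletThomas2002AHP, EckmannPilletReyBellet1999b, KunduDharNarayan2009
[crux] (★) card item U1, the engine, FIXED N. Under weak-NESS uniqueness, for every steady-state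
family μ, T > 0 and response coefficients D (the δ-limits of clause (ii)): for every N ≥ 2, (a) D_N
≥ 0 (entropy production ⟨Σ_t⟩ = σt + KL ≥ 0 for all t forces σ = G_Nδ²/T² + o(δ²) ≥ 0), and (b) for
every bond b, every t > 0 and every K ≥ 0 with KL(μ_{N,δ}‖Θ_*μ_{N,δ}) ≤ Kδ² eventually: 2G_N²t² ≤
V_N(b,t)·(G_N t/T² + K), G_N = D_N/(N−1), V_N as in (S). Derivation (checked by a refuter audit and,
numerically, on the harmonic chain — Numbers): Σ_t := log dP_δ^[0,t]/dΘ̃_*P_δ^[0,t] (Θ̃ = time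
reversal ∘ momentum flip of the stationary path measure) satisfies the joint detailed fluctuation
theorem with the Θ̃-odd Q_t^(b), hence Hasegawa–Van Vu: ⟨Q_t⟩² ≤ ½Var_δ(Q_t)(e^{⟨Σ_t⟩} − 1) at every
δ; ⟨Q_t⟩ = G_Nδt(1+o(1)) (equal mean bond currents), ⟨Σ_t⟩ = σ_δ t + KL(μ_δ‖Θ_*μ_δ) with σ_δ =
J_δ(1/T_R − 1/T_L) (EckmannPilletReyBellet1999b; ReyBelletThomas2002AHP), Var_δ(Q_t) → V_N(b,t) as δ
→ 0 (Gibbs invariance + Markov property of the constructed kernels: Var_eq(∫_0^t j_b) =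
2∫_0^t(t−s)C_N(b,s)ds since μ_T(j_b) = 0); divide by δ² and let δ → 0. Saturates as t → ∞ (V ~
2T²G_N t, KunduDharNarayan2009: -/
@[route_item "route-AtomisticToContinuum-BondHeatFTUR"]
def LinearResponseFTUR : Prop :=
  ∀ ω₂ lam β γ : ℝ, 0 < ω₂ → 0 < lam → 0 < β → 0 < γ → (∀ (N : ℕ) (T_L T_R : ℝ), 0 < T_L → 0 < T_R → ∀ μ ν : MeasureTheory.Measure (Literature.MathematicalPhysics.KineticTheory.HeatConduction.PhaseSpace N), (Literature.MathematicalPhysics.KineticTheory.HeatConduction.pinnedChain ω₂ lam β γ).IsSteadyState N T_L T_R μ → (Literature.MathematicalPhysics.KineticTheory.HeatConduction.pinnedChain ω₂ lam β γ).IsSteadyState N T_L T_R ν → μ = ν) → ∀ μ : (N : ℕ) → ℝ → ℝ → MeasureTheory.Measure (Literature.MathematicalPhysics.KineticTheory.HeatConduction.PhaseSpace N), (∀ (N : ℕ) (T_L T_R : ℝ), 0 < T_L → 0 < T_R → (Literature.MathematicalPhysics.KineticTheory.HeatConduction.pinnedChain ω₂ lam β γ).IsSteadyState N T_L T_R (μ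 N T_L T_R)) → ∀ T : ℝ, 0 < T → ∀ D : ℕ → ℝ, (∀ N : ℕ, Filter.Tendsto (fun δ : ℝ => (Literature.MathematicalPhysics.KineticTheory.HeatConduction.pinnedChain ω₂ lam β γ).totalCurrent (μ N (T + δ / 2) (T - δ / 2)) / δ) (nhdsWithin 0 {(0 : ℝ)}ᶜ) (nhds (D N))) → (let P := Literature.MathematicalPhysics.KineticTheory.HeatConduction.pinnedChain ω₂ lam β γ; let C : ℕ → ℕ → ℝ → ℝ := fun N b s => if h : b < N then ∫ z, P.bondCurrent N ⟨b, h⟩ z * (∫ y, P.bondCurrent N ⟨b, h⟩ y ∂(P.transitionKernel N T T s.toNNReal z)) ∂(P.gibbsMeasure N T) else 0; let V : ℕ → ℕ → ℝ → ℝ := fun N b t => 2 * ∫ s in (0 : ℝ)..t, (t - s) * C N b s; ∀ N : ℕ, 2 ≤ N → 0 ≤ D N ∧ ∀ b : ℕ, b + 1 < N → ∀ t : ℝ, 0 < t → ∀ K : ℝ, 0 ≤ K → (∀ᶠ δ in nhdsWithin (0 : ℝ) {(0 : ℝ)}ᶜ, InformationTheory.klDiv (μ N (T + δ / 2) (T -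 δ / 2)) (MeasureTheory.Measure.map (fun x : Literature.MathematicalPhysics.KineticTheory.HeatConduction.PhaseSpace N => (x.1, -x.2)) (μ N (T + δ / 2) (T - δ / 2))) ≤ ENNReal.ofReal (K * δ ^ 2)) → 2 * (D N / ((N : ℝ) - 1)) ^ 2 * t ^ 2 ≤ V N b t * (D N / ((N : ℝ) - 1) * t / T ^ 2 + K))

/-- item stmt-AtomisticToContinuum-0717 · support · rank 9 · closed · proved by Summit.AtomisticToContinuum.FouriersLaw.Theorems.FourierGreenKubo.finiteResponseOfUnique_holds (prover) · by planner
sources: ReyBellet2003, HairerMajda2009, CuneoEckmannHairerReyBellet2018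
CONDITIONAL FORM OF 0705 (supersedes it as the prover target; refuters pool-5/g3-0: 0705 stand-alone
quantifies over EVERY steady-state family and is false-prone if weak steady states were non-unique):
assuming UNIQUENESS of weak steady states (IsSteadyState class) for pinnedChain at all N, T_L, T_R >
0, the finite-N linear-response limit D_N(T) = lim_{δ→0, δ≠0} totalCurrent(μ_{N,T+δ/2,T−δ/2})/δ
exists for every T > 0 and N. Content: differentiability at equilibrium of NESS expectations of the
polynomial currents in the bath temperatures (ReyBellet2003 arXiv:math-ph/0303021 Rem 4.4 (51)–(56)
finite-volume Green–Kubo; HairerMajda2009 arXiv:0909.4313 Thm 2.3 framework — their SDE Thm 4.4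
Assumption 5 fails here, so verify Assumptions 1–3 via CEHR2018 (2.5)/Carmona2007 Thm 1.1(iv)
weighted spectral gap). N = 0, 1: totalCurrent ≡ 0, D = 0. Together with 0706 gives 0705. -/
@[route_item "route-AtomisticToContinuum-BondHeatFTUR"]
def FiniteResponseOfUnique : Prop :=
  ∀ ω₂ lam β γ : ℝ, 0 < ω₂ → 0 < lam → 0 < β → 0 < γ → (∀ (N : ℕ) (T_L T_R : ℝ), 0 < T_L → 0 < T_R → ∀ μ ν : MeasureTheory.Measure (Literature.MathematicalPhysics.KineticTheory.HeatConduction.PhaseSpace N), (Literature.MathematicalPhysics.KineticTheory.HeatConduction.pinnedChain ω₂ lam β γ).IsSteadyState N T_L T_R μ → (Literature.MathematicalPhysics.KineticTheory.HeatConduction.pinnedChain ω₂ lam β γ).IsSteadyState N T_L T_R ν → μ = ν) → ∀ μ : (N : ℕ) → ℝ → ℝ → MeasureTheory.Measure (Literature.MathematicalPhysics.KineticTheory.HeatConduction.PhaseSpace N), (∀ (N : ℕ) (T_L T_R : ℝ), 0 < T_L → 0 < T_R → (Literature.MathematicalPhysics.KineticTheory.HeatConduction.pinnedChain ω₂ lam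 β γ).IsSteadyState N T_L T_R (μ N T_L T_R)) → ∀ T : ℝ, 0 < T → ∀ N : ℕ, ∃ D : ℝ, Filter.Tendsto (fun δ : ℝ => (Literature.MathematicalPhysics.KineticTheory.HeatConduction.pinnedChain ω₂ lam β γ).totalCurrent (μ N (T + δ / 2) (T - δ / 2)) / δ) (nhdsWithin 0 {(0 : ℝ)}ᶜ) (nhds D)

/-- item stmt-AtomisticToContinuum-0741 · support · rank 9 · closed · proved by Summit.AtomisticToContinuum.FouriersLaw.Theorems.nessUnique_proof (prover) · by planner
[crux] UNIQUENESS OF THE WEAK STEADY STATE (the half of stmt-0706 not covered by the landed fact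
Literature.MathematicalPhysics.KineticTheory.HeatConduction.CuneoEckmannHairerReyBellet2018_pinnedChain,
p3544): for pinnedChain ω₂ lam β γ (all > 0), every N and T_L, T_R > 0, any two measures in the weak
Fokker–Planck class IsSteadyState (probability, ∫ L f dμ = 0 for f ∈ C_c^∞, bond currents
integrable) coincide. Print: uniqueness of the INVARIANT MEASURE of the Langevin semigroup
(CuneoEckmannHairerReyBellet2018 Thm 2.13(1): C1, C2, CA; Carmona2007 Thm 1.1(iii)); the item
additionally needs 'weak stationary probability solution of L*μ = 0 ⇒ P_t-invariant' for this
hypoelliptic L with cubic drift (Echeverría 1982 well-posed martingale problem on C_c^∞ +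
non-explosion via e^{θH}; Bogachev–Krylov–Röckner–Shaposhnikov 2015 Ch. 5 is non-degenerate only) —
the FP-identification lemma is the formal crux. N = 0: PhaseSpace 0 is a point (unique probability
measure); N = 1: both baths on site 0, OU at temperature (T_L+T_R)/2. This is exactly the hypothesis
of FiniteResponse and ThermodynamicLimit and, with the fact, gives clause (i) of FouriersLawFor. -/
@[route_item "route-AtomisticToContinuum-BondHeatFTUR"]
def NessUnique : Prop :=
  ∀ ω₂ lam β γ : ℝ, 0 < ω₂ → 0 < lam → 0 < β → 0 < γ → ∀ (N : ℕ) (T_L T_R : ℝ), 0 < T_L → 0 < T_R → ∀ μ ν : MeasureTheory.Measure (Literature.MathematicalPhysics.KineticTheory.HeatConduction.PhaseSpace N), (Literature.MathematicalPhysics.KineticTheory.HeatConduction.pinnedChain ω₂ lam β γ).IsSteadyState N T_L T_R μ → (Literature.MathematicalPhysics.KineticTheory.HeatConduction.pinnedChain ω₂ lam β γ).IsSteadyState N T_L T_R ν → μ = ν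

/-- `NessUnique` holds: proved by `Summit.AtomisticToContinuum.FouriersLaw.Theorems.nessUnique_proof`. -/
theorem NessUnique_holds : NessUnique := _root_.Summit.AtomisticToContinuum.FouriersLaw.Theorems.nessUnique_proof

/-- item stmt-AtomisticToContinuum-2187 · support · rank 9 · closed · moot by None · by planner
sources: BonettoLebowitzReyBellet2000, Literature.Barriers.AtomisticToContinuum.HasBoundedResponse
[crux] BOUNDED RESPONSE = the catalogued necessary waypoint
Literature.Barriers.AtomisticToContinuum.HasBoundedResponse (pinnedChain ω₂ lam β γ) for all ω₂,
lam, β, γ > 0: along every steady-state family and every T > 0 the finite-size conductivities |D_N|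
are bounded in N (J ≤ C δT/N). Necessary for the conjunct (hasBoundedResponse_of_fouriersLawFor,
proved in tree) and FALSE at lam = β = 0 (HarmonicChainBallisticFlux.not_hasBoundedResponse), so any
proof uses anharmonicity non-perturbatively; under NessUnique the family quantifier collapses to the
canonical family (hasBoundedResponse_iff_of_unique). In the Fekete assembly it is exactly what
upgrades ℓ = lim R_N/N ≥ 0 to ℓ ≥ 1/S > 0, i.e. κ < ∞. This route claims NO new engine for it
(shared residual crux of every FouriersLaw line; the companion cards
insertion-cost-superadditive-half / superadditive-junction-dichotomy reduce it to the superadditive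
half of the series law plus one finite-N certificate, conservation-law-rigidity-local-ohm to a local
Ohm inequality). -/
@[route_item "route-AtomisticToContinuum-BondHeatFTUR"]
def BoundedResponse : Prop :=
  ∀ ω₂ lam β γ : ℝ, 0 < ω₂ → 0 < lam → 0 < β → 0 < γ → Literature.Barriers.AtomisticToContinuum.HasBoundedResponse (Literature.MathematicalPhysics.KineticTheory.HeatConduction.pinnedChain ω₂ lam β γ)

/-- item stmt-AtomisticToContinuum-2192 · support · rank 9 · closed · moot by None · by planner
sources: BonettoLebowitzReyBellet2000, Mazur1969
[crux] NOT BALLISTIC: under weak-NESS uniqueness, for every steady-state family of pinnedChain ω₂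
lam β γ (all > 0), T > 0 and the response coefficients D_N: for every ε > 0 there are arbitrarily
long chains with D_N ≤ ε(N−1), i.e. the conductance G_N = J_N/δT = D_N/(N−1) is not bounded away
from 0. NECESSARY for the conjunct (FouriersLawFor ⇒ HasBoundedResponse ⇒ G_N → 0): a refutation
refutes FouriersLaw itself (then file ¬FouriersLaw). Two ways in: (a) CERTIFICATE — once
SuperadditiveResistance holds with an explicit C(T), this item is equivalent (given D_N > 0) to ONE
N₀ ≥ 2 with (N₀−1)/D_{N₀}(T) > C(T), decidable by certified two-sided bounds on the stationary
linear response of a 2N₀-dimensional hypoelliptic polynomial diffusion (moment/SOS relaxations of ∫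
L f dμ = 0: doi:10.1137/16m107801x, doi:10.1137/15m1053347); by the scaling conjugacy D_N(T; lam, β)
= D_N(1; lam T, β T), N₀(T) → ∞ as T → 0 and '∀ T' needs compact-T families plus asymptotics; (b)
SOFT — an ergodic/entropy argument that ballistic conduction at every length forces a non-thermal
single-contact state (card single-thermostat-rigidity). Fails exactly for the harmonic member
(HarmonicCalibration). -/
@[route_item "route-AtomisticToContinuum-BondHeatFTUR"]
def NonBallistic : Prop :=
  ∀ ω₂ lam β γ : ℝ, 0 < ω₂ → 0 < lam → 0 < β → 0 < γ → (∀ (N : ℕ) (T_L T_R : ℝ), 0 < T_L → 0 < T_R → ∀ μ ν : MeasureTheory.Measure (Literature.MathematicalPhysics.KineticTheory.HeatConduction.PhaseSpace N), (Literature.MathematicalPhysics.KineticTheory.HeatConduction.pinnedChain ω₂ lam β γ).IsSteadyState N T_L T_R μ → (Literature.MathematicalPhysics.KineticTheory.HeatConduction.pinnedChain ω₂ lam β γ).IsSteadyState N T_L T_R ν → μ = ν) → ∀ μ : (N : ℕ) → ℝ → ℝ → MeasureTheory.Measure (Literature.MathematicalPhysics.KineticTheory.HeatConduction.PhaseSpace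 N), (∀ (N : ℕ) (T_L T_R : ℝ), 0 < T_L → 0 < T_R → (Literature.MathematicalPhysics.KineticTheory.HeatConduction.pinnedChain ω₂ lam β γ).IsSteadyState N T_L T_R (μ N T_L T_R)) → ∀ T : ℝ, 0 < T → ∀ D : ℕ → ℝ, (∀ N : ℕ, Filter.Tendsto (fun δ : ℝ => (Literature.MathematicalPhysics.KineticTheory.HeatConduction.pinnedChain ω₂ lam β γ).totalCurrent (μ N (T + δ / 2) (T - δ / 2)) / δ) (nhdsWithin 0 {(0 : ℝ)}ᶜ) (nhds (D N))) → ∀ ε : ℝ, 0 < ε → ∀ N₀ : ℕ, ∃ N : ℕ, N₀ ≤ N ∧ D N ≤ ε * ((N : ℝ) - 1)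

/-- item stmt-AtomisticToContinuum-6009 · support · rank 9 · closed · moot by None · by planner
sources: ButtaEtAl2007, MendlSpohn2015, Spohn2014, doi:10.1023/a:1014577928229
[support] (S_lc) the light-cone special case of (S) (card U2 fallback / U4): same objects, window 1
≤ t ≤ a·N only — inside the cone t ≤ N/(2v) a bulk bond of the open chain does not feel the baths
(thermal Lieb–Robinson / finite-speed bounds for quartic chains, ButtaEtAl2007), so this is the √t
law of the INFINITE equilibrium chain transported to the open one. Literally implied by
SubdiffusiveBondHeat (take N ≥ a/c); filed separately because with (K) and (★) it alone gives G_N →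
0 (TransferToNonBallistic). The cheapest N-uniform statement of the line. [difficulty: XL] -/
@[route_item "route-AtomisticToContinuum-BondHeatFTUR"]
def LightConeBondHeat : Prop :=
  ∀ ω₂ lam β γ : ℝ, 0 < ω₂ → 0 < lam → 0 < β → 0 < γ → ∀ T : ℝ, 0 < T → (let P := Literature.MathematicalPhysics.KineticTheory.HeatConduction.pinnedChain ω₂ lam β γ; let C : ℕ → ℕ → ℝ → ℝ := fun N b s => if h : b < N then ∫ z, P.bondCurrent N ⟨b, h⟩ z * (∫ y, P.bondCurrent N ⟨b, h⟩ y ∂(P.transitionKernel N T T s.toNNReal z)) ∂(P.gibbsMeasure N T) else 0; let V : ℕ → ℕ → ℝ → ℝ := fun N b t => 2 * ∫ s in (0 : ℝ)..t, (t - s) * C N b s; ∃ A a : ℝ, 0 < a ∧ ∃ N₀ : ℕ, ∀ N : ℕ, N₀ ≤ N → ∃ b : ℕ, b + 1 < N ∧ ∀ t : ℝ, 1 ≤ t → t ≤ a * (N : ℝ) → V N b t ≤ A * Real.sqrt t)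

/-- item stmt-AtomisticToContinuum-6010 · support · rank 9 · closed · moot by None · by planner
sources: BonettoLebowitzReyBellet2000, HasegawaVanVu2019
[support] GLUE, PROVED sorry-free in the planner folder (Sketch.lean, theorem
transferToBoundedResponse_holds, axioms propext/Classical.choice/Quot.sound; ~110 lines of real
arithmetic, copy into Theorems/): LinearResponseFTUR → SubdiffusiveBondHeat →
ExtensiveSnapshotIrreversibility → NessUnique → BoundedResponse. Proof: at N ≥ max(N₀, 2, ⌈1/c⌉)
take the bond of (S), t = cN² (≥ 1), K = max(C,0)·N; since G_N ≥ 0 and K ≥ 0 the factor G_Nt/T² + K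
is ≥ 0, so V may be replaced by its bound max(A,0)√c·N WITHOUT any sign information on V; with x =
N·G_N this reads 2c²x² ≤ Px + Q, hence x ≤ max(1,(P+Q)/(2c²)) and 0 ≤ D_N ≤ N·G_N; finitely many
small N are absorbed. Mesh test of the typed quantifiers: passed. [difficulty: provable-now] -/
@[route_item "route-AtomisticToContinuum-BondHeatFTUR"]
def TransferToBoundedResponse : Prop :=
  LinearResponseFTUR → SubdiffusiveBondHeat → ExtensiveSnapshotIrreversibility → NessUnique → BoundedResponse

/-- item stmt-AtomisticToContinuum-6011 · support · rank 9 · closed · moot by None · by planner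
sources: BonettoLebowitzReyBellet2000, HasegawaVanVu2019
[support] GLUE for the qualitative rung, PROVED sorry-free in the planner folder (theorem
transferToNonBallistic_holds): LinearResponseFTUR → LightConeBondHeat →
ExtensiveSnapshotIrreversibility → NessUnique → NonBallistic. Proof: at t = aN, with r = √N, (★)
gives 2a²rG² ≤ PG + Q; if G_N > ε then 2a²εr < P + Q/ε, i.e. N < ((P + Q/ε)/(2a²ε))², so beyond that
length D_N ≤ ε(N−1). Quantitatively G_N ≤ c₁N^(−1/2) + c₂N^(−1/4), D_N = O(N^(3/4)): sub-ballistic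
transport from light-cone equilibrium data + data processing alone. [difficulty: provable-now] -/
@[route_item "route-AtomisticToContinuum-BondHeatFTUR"]
def TransferToNonBallistic : Prop :=
  LinearResponseFTUR → LightConeBondHeat → ExtensiveSnapshotIrreversibility → NessUnique → NonBallistic

/-- item stmt-AtomisticToContinuum-6012 · support · rank 9 · closed · moot by None · by planner
sources: BonettoLebowitzReyBellet2000, Hammersley1988, CanestrariLiveraniOlla2026
[support] IMPORT SLOT (what this line does NOT supply: a lower bound and existence of the limit).
Under weak-NESS uniqueness, for every steady-state family, T > 0 and response coefficients D: D_N
converges in EReal to some ℓ ∈ (0, +∞]. NECESSARY for the conjunct (D_N → κ(T) > 0), so not too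
strong; together with BoundedResponse it gives D_N → κ ∈ (0,∞). Suppliers: FeketeResistance minus
its crux (B) (QuasiSubadditiveResistance + PositiveConductance + Fekete on {N ≥ 2} give R_N/N → ℓ' ∈
[0,∞), i.e. D_N → 1/ℓ' ∈ (0,+∞]); SuperadditiveJunction ((A)+(B)+(C) ⇒ real positive limit);
EscapeDeficit's bracket + EscapeNonOscillation. Dedup by signature will not catch those — the tenure
planner re-points the Assembly when one lands. Provers of THIS route should not start here.
[difficulty: L] -/
@[route_item "route-AtomisticToContinuum-BondHeatFTUR"]
def PositiveOrInfiniteLimit : Prop :=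
  ∀ ω₂ lam β γ : ℝ, 0 < ω₂ → 0 < lam → 0 < β → 0 < γ → (∀ (N : ℕ) (T_L T_R : ℝ), 0 < T_L → 0 < T_R → ∀ μ ν : MeasureTheory.Measure (Literature.MathematicalPhysics.KineticTheory.HeatConduction.PhaseSpace N), (Literature.MathematicalPhysics.KineticTheory.HeatConduction.pinnedChain ω₂ lam β γ).IsSteadyState N T_L T_R μ → (Literature.MathematicalPhysics.KineticTheory.HeatConduction.pinnedChain ω₂ lam β γ).IsSteadyState N T_L T_R ν → μ = ν) → ∀ μ : (N : ℕ) → ℝ → ℝ → MeasureTheory.Measure (Literature.MathematicalPhysics.KineticTheory.HeatConduction.PhaseSpace N), (∀ (N : ℕ) (T_L T_R : ℝ), 0 < T_L → 0 < T_R → (Literature.MathematicalPhysics.KineticTheory.HeatConduction.pinnedChain ω₂ lam β γ).IsSteadyState N T_L T_R (μ N T_L T_R)) → ∀ T : ℝ, 0 < T → ∀ D : ℕ → ℝ, (∀ N : ℕ, Filter.Tendsto (fun δ : ℝ => (Literature.MathematicalPhysics.KineticTheory.HeatConduction.pinnedChain ω₂ lam β γ).totalCurrent (μ N (T + δ / 2)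 (T - δ / 2)) / δ) (nhdsWithin 0 {(0 : ℝ)}ᶜ) (nhds (D N))) → ∃ ℓ : EReal, 0 < ℓ ∧ Filter.Tendsto (fun N : ℕ => ((D N : ℝ) : EReal)) Filter.atTop (nhds ℓ)

/-- item stmt-AtomisticToContinuum-6013 · assembly · rank 1 · closed · moot by None · by planner
sources: BonettoLebowitzReyBellet2000, CuneoEckmannHairerReyBellet2018
[assembly] TransferToBoundedResponse → LinearResponseFTUR → SubdiffusiveBondHeat →
ExtensiveSnapshotIrreversibility → (fact CuneoEckmannHairerReyBellet2018_pinnedChain, PROVED in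
tree) → NessUnique → FiniteResponseOfUnique → PositiveOrInfiniteLimit → FouriersLaw. -/
@[route_item "route-AtomisticToContinuum-BondHeatFTUR"]
def Assembly : Prop :=
  TransferToBoundedResponse → LinearResponseFTUR → SubdiffusiveBondHeat → ExtensiveSnapshotIrreversibility → Literature.MathematicalPhysics.KineticTheory.HeatConduction.CuneoEckmannHairerReyBellet2018_pinnedChain → NessUnique → FiniteResponseOfUnique → PositiveOrInfiniteLimit → Literature.MathematicalPhysics.KineticTheory.HeatConduction.FouriersLaw

end Summit.AtomisticToContinuum.FouriersLaw.Theses.BondHeatFTUR
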